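import Mathlib
import Literature.Probability.Divergences.FDivVariational
import HarnessLib

/-!
# Box-wise entropy inequality at a single rate `γ` (tensorisation) — stub S1

Helper file (`--supports stmt-AtomisticToContinuum-15145`) proving the registered stub
`stub_entropyInequalityTensorised` of the lead's skeleton for the crux
`Summit.AtomisticToContinuum.HydrodynamicLimit.Theses.TwoClocks.ClampedEntropyClock`
(line `IdeatorTwoSketch`, card `quenched-cell-clock`): the entropy budget is spent cell by cell against a
PRODUCT reference `α ⊗ β` at ONE rate `γ`.

Proof. The entropy inequality `∫ g dμ ≤ KL(μ ‖ ν) + log ∫ e^g dν` for probability measures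
(`integral_le_toReal_klDiv_add_log_integral_exp`, obtained from the tree's Gibbs / Fenchel–Young bound
`Literature.Probability.Divergences.integral_le_toReal_klDiv_add_integral`
`∫ g dμ ≤ KL(μ ‖ ν) + ∫ (e^g - 1) dν` applied to the shifted observable `g - log ∫ e^g dν`), with
`μ = f`, `ν = α ⊗ β`, `g = γ (F ⊕ G)`, followed by Fubini
`∫ e^{γ F(x) + γ G(y)} d(α ⊗ β) = (∫ e^{γF} dα) (∫ e^{γG} dβ)` (`MeasureTheory.integral_prod_mul`),
`log (A B) = log A + log B`, and division by `γ > 0`.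
-/

noncomputable section

open MeasureTheory InformationTheory
open scoped ENNReal

namespace Summit.AtomisticToContinuum.HydrodynamicLimit.Theorems.QuenchedCellClock

/-- **Entropy inequality** (Gibbs / Donsker–Varadhan easy half, for Mathlib's `klDiv`): for probability
measures `μ, ν` with `KL(μ ‖ ν) < ∞`, every `μ`-integrable `g` with `e^g` `ν`-integrable satisfies
`∫ g dμ ≤ KL(μ ‖ ν) + log ∫ e^g dν`. Obtained from the Fenchel–Young form
`∫ g dμ ≤ KL(μ ‖ ν) + ∫ (e^g - 1) dν` at the optimally shifted observable `g - log ∫ e^g dν`.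
[cite: KipnisLandim1999, Appendix 1 §8] -/
theorem integral_le_toReal_klDiv_add_log_integral_exp {Ω : Type*} [MeasurableSpace Ω]
    (μ ν : Measure Ω) [IsProbabilityMeasure μ] [IsProbabilityMeasure ν]
    (hfin : klDiv μ ν ≠ ∞) {g : Ω → ℝ} (hg : Integrable g μ)
    (hexp : Integrable (fun x => Real.exp (g x)) ν) :
    ∫ x, g x ∂μ ≤ (klDiv μ ν).toReal + Real.log (∫ x, Real.exp (g x) ∂ν) := by
  set I := ∫ x, Real.exp (g x) ∂ν with hI
  have hIpos : 0 < I := integral_exp_pos hexp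
  set c := -Real.log I with hc
  have hg' : Integrable (fun x => g x + c) μ := hg.add (integrable_const c)
  have hfun : (fun x => Real.exp (g x + c)) = fun x => Real.exp (g x) * Real.exp c := by
    funext x
    rw [Real.exp_add]
  have hexp' : Integrable (fun x => Real.exp (g x + c)) ν := by
    rw [hfun]
    exact hexp.mul_const _
  have h := Literature.Probability.Divergences.integral_le_toReal_klDiv_add_integral hfin hg' hexp'
  have h1 : ∫ x, (g x + c) ∂μ = ∫ x, g x ∂μ + c := by
    rw [integral_add hg (integrable_const c), integral_const, probReal_univ, one_smul]
  have h2 : ∫ x, (Real.exp (g x + c) - 1) ∂ν = 0 := by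
    rw [integral_sub hexp' (integrable_const _), integral_const, probReal_univ, one_smul, hfun,
      integral_mul_const, ← hI, hc, Real.exp_neg, Real.exp_log hIpos, mul_inv_cancel₀ hIpos.ne',
      sub_self]
  rw [h1, h2, add_zero] at h
  have hlog : -c = Real.log I := by rw [hc, neg_neg]
  linarith

/-- **Stub S1 — box-wise entropy inequality at a single `γ` (tensorisation).** For a probability law `f` on
`X × Y` and a PRODUCT reference `α ⊗ β` (probability measures), measurable `F, G`, `γ > 0`, finite
`KL(f ‖ α ⊗ β)`, `e^{γF} ∈ L¹(α)`, `e^{γG} ∈ L¹(β)` and `F ⊕ G ∈ L¹(f)`: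
`∫ (F x + G y) df ≤ γ⁻¹ [KL(f ‖ α⊗β) + log ∫ e^{γF} dα + log ∫ e^{γG} dβ]` (the entropy inequality for the
reference `α ⊗ β` and the function `γ(F ⊕ G)`, plus Fubini `∫ e^{γF ⊕ γG} d(α⊗β) = ∫e^{γF}dα · ∫e^{γG}dβ`).
[cite: KipnisLandim1999, Appendix 1 §8] -/
theorem stub_entropyInequalityTensorised {X Y : Type*} [MeasurableSpace X] [MeasurableSpace Y]
    (f : Measure (X × Y)) [IsProbabilityMeasure f] (α : Measure X) (β : Measure Y)
    [IsProbabilityMeasure α] [IsProbabilityMeasure β]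
    (F : X → ℝ) (G : Y → ℝ) (_hF : Measurable F) (_hG : Measurable G) {γ : ℝ} (hγ : 0 < γ)
    (hfin : klDiv f (α.prod β) ≠ ⊤)
    (hiF : Integrable (fun x => Real.exp (γ * F x)) α)
    (hiG : Integrable (fun y => Real.exp (γ * G y)) β)
    (hint : Integrable (fun p : X × Y => F p.1 + G p.2) f) :
    ∫ p, (F p.1 + G p.2) ∂f ≤
      γ⁻¹ * ((klDiv f (α.prod β)).toReal + Real.log (∫ x, Real.exp (γ * F x) ∂α) +
        Real.log (∫ y, Real.exp (γ * G y) ∂β)) := by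
  have hA : 0 < ∫ x, Real.exp (γ * F x) ∂α := integral_exp_pos hiF
  have hB : 0 < ∫ y, Real.exp (γ * G y) ∂β := integral_exp_pos hiG
  -- the exponential of `γ (F ⊕ G)` factorises over the product
  have hprod_eq : (fun p : X × Y => Real.exp (γ * (F p.1 + G p.2))) =
      fun p : X × Y => Real.exp (γ * F p.1) * Real.exp (γ * G p.2) := by
    funext p
    rw [mul_add, Real.exp_add]
  have hexp : Integrable (fun p : X × Y => Real.exp (γ * (F p.1 + G p.2))) (α.prod β) := by
    rw [hprod_eq]
    exact hiF.mul_prod hiG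
  -- Fubini: `∫ e^{γF ⊕ γG} d(α ⊗ β) = (∫ e^{γF} dα) (∫ e^{γG} dβ)`
  have hI : ∫ p, Real.exp (γ * (F p.1 + G p.2)) ∂(α.prod β) =
      (∫ x, Real.exp (γ * F x) ∂α) * ∫ y, Real.exp (γ * G y) ∂β := by
    rw [hprod_eq]
    exact integral_prod_mul (fun x => Real.exp (γ * F x)) (fun y => Real.exp (γ * G y))
  have hg : Integrable (fun p : X × Y => γ * (F p.1 + G p.2)) f := hint.const_mul γ
  -- the entropy inequality for `ν = α ⊗ β`, `g = γ (F ⊕ G)`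
  have h := integral_le_toReal_klDiv_add_log_integral_exp f (α.prod β) hfin hg hexp
  rw [hI, Real.log_mul hA.ne' hB.ne', integral_const_mul] at h
  rw [le_inv_mul_iff₀ hγ]
  linarith

end Summit.AtomisticToContinuum.HydrodynamicLimit.Theorems.QuenchedCellClock

end
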